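import Summits.AnomalousDissipation.AnomalousDissipation.Theorems.FloorCertificate.Negative.WeakDuality
import Literature.Analysis.FluidPDE.CylindricalGenerator
import Literature.Analysis.FunctionSpaces.TorusSobolevNormFacts
import Literature.Analysis.FunctionSpaces.TorusSobolevSpaceProofs

/-!
# `TaylorCertificates.FloorCertificateEnsembleCeiling` (stmt-AnomalousDissipation-14086) — negative side IX:
# the finite-enstrophy GUARD of the floor is load-bearing (formal anatomy)

cdisprove seat `refuter-cdisprove-stmt-AnomalousDissipation-14086-g3-0` (generation 3, 2026-08-16).

X's FLOOR quantifies over the states `u ∈ H` of the Leray ball WITH FINITE ENSTROPHY (`Torus.eGradNormSq u ≠ ⊤`).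
The Disproof work file (§G) notes informally that the guard "only removes the junk `D = ν·(⊤).toReal = 0`". This
file makes the remark a theorem and shows the guard is genuinely load-bearing at the formal level:

* `floorWithoutGuard_false_at_rough_states` — engine: if the floor inequality is demanded at EVERY state of the ball
  (no guard), with `ε₀ > 0`, `θ₁ ≤ 0`, `ν > 0`, `f ∈ L²`, then NO state of `H` has infinite enstrophy. Mechanism: at
  an infinite-enstrophy state the dissipation term reads `ν·(⊤).toReal = 0`, so the inequality degenerates to
  `ε₀ ≤ ⟨F(u),Φ₁'(u)⟩ + 2θ₁(u,f)`; rough states `u* + t r` accumulate (in `L²`) at Temam's steady state `u*`, where the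
  tested generator vanishes and `2θ₁(u*,f) = 2θ₁ν‖∇u*‖² ≤ 0`, and both terms are norm-continuous on `H`
  (`continuous_nsGeneratorPairing_grad`, `continuous_pairing_coe`); so `ε₀ ≤ 0` in the limit. (For `f = 0` the
  unguarded floor already fails at rest.)
* `floorCertificateEnsembleCeiling_withoutGuard_forces_finite_enstrophy` — read on the crux: `X` with the guard
  deleted would force `H = V` (every finite-energy solenoidal field would have finite enstrophy) — i.e. the unguarded
  statement is false as soon as ONE infinite-enstrophy element of `H` is exhibited (not constructed here: the tree has
  no named rough element of `H` yet; the implication is the kernel-checked content).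

So any proof of `X` uses the guard exactly once: to discard the rough states, at which the certificate inequality is
not the intended one. Def-free; nothing here asserts a Theses statement.
-/

noncomputable section

set_option linter.dupNamespace false

open MeasureTheory UnitAddTorus Filter Topology
open scoped InnerProductSpace ENNReal

namespace Summit.AnomalousDissipation.AnomalousDissipation.Theorems.FloorCertificateEnsembleCeiling.Negative

open Literature.Analysis.FunctionSpaces Literature.Analysis.FluidPDE
open Summit.AnomalousDissipation.AnomalousDissipation.Theses.TaylorCertificates
open Summit.AnomalousDissipation.AnomalousDissipation.Theorems.TaylorCertificatePair.Negative
open Summit.AnomalousDissipation.AnomalousDissipation.Theorems.FloorCertificate.Negative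

/-- If `u* ∈ V` and `u* + t • r` has finite enstrophy for some `t ≠ 0`, then `r` has finite enstrophy
(`V` is a linear subspace: `Torus.MemSobolev.sub_holds`, `Torus.MemSobolev.real_smul`, a.e.-invariance). -/
theorem eGradNormSq_ne_top_of_add_smul {us r : Torus.energySpace (Fin 3)} {t : ℝ} (ht : t ≠ 0)
    (hus : (us : Lp (EuclideanSpace ℝ (Fin 3)) 2 (volume : Measure (UnitAddTorus (Fin 3)))) ∈ Torus.energySpaceV (Fin 3))
    (hfin : Torus.eGradNormSq (((us + t • r : Torus.energySpace (Fin 3)) : Lp (EuclideanSpace ℝ (Fin 3)) 2 (volume : Measure (UnitAddTorus (Fin 3)))) : UnitAddTorus (Fin 3) → EuclideanSpace ℝ (Fin 3)) ≠ ⊤) :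
    Torus.eGradNormSq ((r : Lp (EuclideanSpace ℝ (Fin 3)) 2 (volume : Measure (UnitAddTorus (Fin 3)))) : UnitAddTorus (Fin 3) → EuclideanSpace ℝ (Fin 3)) ≠ ⊤ := by
  set U : UnitAddTorus (Fin 3) → EuclideanSpace ℝ (Fin 3) :=
    ((us : Lp (EuclideanSpace ℝ (Fin 3)) 2 (volume : Measure (UnitAddTorus (Fin 3)))) : UnitAddTorus (Fin 3) → EuclideanSpace ℝ (Fin 3)) with hU
  set W : UnitAddTorus (Fin 3) → EuclideanSpace ℝ (Fin 3) :=
    (((us + t • r : Torus.energySpace (Fin 3)) : Lp (EuclideanSpace ℝ (Fin 3)) 2 (volume : Measure (UnitAddTorus (Fin 3)))) : UnitAddTorus (Fin 3) → EuclideanSpace ℝ (Fin 3)) with hW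
  set R : UnitAddTorus (Fin 3) → EuclideanSpace ℝ (Fin 3) :=
    ((r : Lp (EuclideanSpace ℝ (Fin 3)) 2 (volume : Measure (UnitAddTorus (Fin 3)))) : UnitAddTorus (Fin 3) → EuclideanSpace ℝ (Fin 3)) with hR
  have hWmem : MemLp W 2 volume := Lp.memLp _
  have h1 : Torus.MemSobolev 1 (⇑EuclideanSpace.complexify ∘ W) :=
    Torus.memSobolev_one_complexify_of_eGradNormSq_ne_top hWmem hfin
  have h2 : Torus.MemSobolev 1 (⇑EuclideanSpace.complexify ∘ U) := hus.2
  have h3 : Torus.MemSobolev 1 (⇑EuclideanSpace.complexify ∘ W - ⇑EuclideanSpace.complexify ∘ U) :=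
    Torus.MemSobolev.sub_holds h1 h2
  -- `W - U = t • R` almost everywhere
  have hae : (⇑EuclideanSpace.complexify ∘ W - ⇑EuclideanSpace.complexify ∘ U) =ᵐ[volume]
      (t • (⇑EuclideanSpace.complexify ∘ R)) := by
    have hcoe : (((us + t • r : Torus.energySpace (Fin 3)) : Lp (EuclideanSpace ℝ (Fin 3)) 2 (volume : Measure (UnitAddTorus (Fin 3))))) =
        (us : Lp (EuclideanSpace ℝ (Fin 3)) 2 (volume : Measure (UnitAddTorus (Fin 3)))) +
          t • (r : Lp (EuclideanSpace ℝ (Fin 3)) 2 (volume : Measure (UnitAddTorus (Fin 3)))) := by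
      rw [Submodule.coe_add, Submodule.coe_smul]
    have hW' : W =ᵐ[volume] U + t • R := by
      rw [hW, hcoe]
      filter_upwards [Lp.coeFn_add (us : Lp (EuclideanSpace ℝ (Fin 3)) 2 (volume : Measure (UnitAddTorus (Fin 3))))
          (t • (r : Lp (EuclideanSpace ℝ (Fin 3)) 2 (volume : Measure (UnitAddTorus (Fin 3))))),
        Lp.coeFn_smul t (r : Lp (EuclideanSpace ℝ (Fin 3)) 2 (volume : Measure (UnitAddTorus (Fin 3))))] with x hx hx'
      rw [hx, Pi.add_apply, hx']
      rfl
    filter_upwards [hW'] with x hx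
    simp only [Pi.sub_apply, Function.comp_apply, Pi.smul_apply, hx, Pi.add_apply]
    rw [map_add, add_sub_cancel_left, LinearIsometry.map_smul]
  have h4 : Torus.MemSobolev 1 (t • (⇑EuclideanSpace.complexify ∘ R)) := Torus.MemSobolev.ae_eq hae h3
  have h5 : Torus.MemSobolev 1 (⇑EuclideanSpace.complexify ∘ R) := by
    have h := Torus.MemSobolev.real_smul t⁻¹ h4
    rwa [smul_smul, inv_mul_cancel₀ ht, one_smul] at h
  exact h5.eGradNormSq_lt_top.ne

/-- **The unguarded floor is false at rough states (engine).** If the FLOOR inequality with budget `ε₀ > 0`,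
weight `θ₁ ≤ 0`, viscosity `ν > 0` and force `f ∈ L²` is demanded at EVERY state of the Leray ball — without the
finite-enstrophy guard — then every state of `H` has finite enstrophy. -/
theorem floorWithoutGuard_false_at_rough_states {ν : ℝ} (hν : 0 < ν) {f : UnitAddTorus (Fin 3) → EuclideanSpace ℝ (Fin 3)}
    (hf : MemLp f 2 volume) {ε₀ θ₁ : ℝ} (hε₀ : 0 < ε₀) (hθ₁ : θ₁ ≤ 0) {Φ₁ : Torus.CylindricalTest (Fin 3)}
    (hfloor : ∀ u : Torus.energySpace (Fin 3), ‖u‖ ^ 2 ≤ 16 * (∫ x, ‖f x‖ ^ 2) / ν ^ 2 →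
      ε₀ ≤ ν * (Torus.eGradNormSq ((u : Lp (EuclideanSpace ℝ (Fin 3)) 2 (volume : Measure (UnitAddTorus (Fin 3)))) : UnitAddTorus (Fin 3) → EuclideanSpace ℝ (Fin 3))).toReal +
        Torus.nsGeneratorPairing ν f u (Φ₁.grad u) +
        2 * θ₁ * (Torus.pairing (u : Lp (EuclideanSpace ℝ (Fin 3)) 2 (volume : Measure (UnitAddTorus (Fin 3)))) f -
          ν * (Torus.eGradNormSq ((u : Lp (EuclideanSpace ℝ (Fin 3)) 2 (volume : Measure (UnitAddTorus (Fin 3)))) : UnitAddTorus (Fin 3) → EuclideanSpace ℝ (Fin 3))).toReal))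
    (r : Torus.energySpace (Fin 3)) :
    Torus.eGradNormSq ((r : Lp (EuclideanSpace ℝ (Fin 3)) 2 (volume : Measure (UnitAddTorus (Fin 3)))) : UnitAddTorus (Fin 3) → EuclideanSpace ℝ (Fin 3)) ≠ ⊤ := by
  intro hr
  set F : ℝ := ∫ x, ‖f x‖ ^ 2 with hFdef
  have hFnn : 0 ≤ F := integral_nonneg fun x => by positivity
  -- Step A: the force is not (a.e.) zero, else the unguarded floor fails at rest.
  have hFpos : 0 < F := by
    refine lt_of_le_of_ne hFnn fun hF0 => ?_
    have hrest := floor_at_rest (Φ₁ := Φ₁) (θ₁ := θ₁) (ε₀ := ε₀) hν (f := f) (fun _ hb => hfloor 0 hb)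
    have hint : Integrable (fun x => ‖f x‖ ^ 2) volume := (memLp_two_iff_integrable_sq_norm hf.1).1 hf
    have hae0 : (fun x => ‖f x‖ ^ 2) =ᵐ[volume] 0 :=
      (integral_eq_zero_iff_of_nonneg (fun x => by positivity) hint).1 hF0.symm
    have hf0 : f =ᵐ[volume] 0 := by
      filter_upwards [hae0] with x hx
      have : ‖f x‖ ^ 2 = 0 := hx
      exact norm_eq_zero.1 (pow_eq_zero_iff two_ne_zero |>.1 this)
    have hzero : (∫ x, ⟪f x, Φ₁.grad 0 x⟫_ℝ) = 0 := by
      rw [← integral_zero (α := UnitAddTorus (Fin 3)) (G := ℝ)]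
      refine integral_congr_ae ?_
      filter_upwards [hf0] with x hx
      simp [hx]
    linarith
  -- Step B: Temam's steady state sits strictly inside the ball.
  obtain ⟨us, husV, hus⟩ := Torus.Temam1979_exists_steadyWeakSolution_holds (by simp) hν hf
  have hfinus : Torus.eGradNormSq ((us : Lp (EuclideanSpace ℝ (Fin 3)) 2 (volume : Measure (UnitAddTorus (Fin 3)))) : UnitAddTorus (Fin 3) → EuclideanSpace ℝ (Fin 3)) ≠ ⊤ :=
    husV.2.eGradNormSq_lt_top.ne
  set G : ℝ := (Torus.eGradNormSq ((us : Lp (EuclideanSpace ℝ (Fin 3)) 2 (volume : Measure (UnitAddTorus (Fin 3)))) : UnitAddTorus (Fin 3) → EuclideanSpace ℝ (Fin 3))).toReal with hGdef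
  have hG0 : 0 ≤ G := ENNReal.toReal_nonneg
  have henergy : ν * G = Torus.pairing (us : Lp (EuclideanSpace ℝ (Fin 3)) 2 (volume : Measure (UnitAddTorus (Fin 3)))) f :=
    Torus.IsSteadyWeakSolution.energy_eq' (d := Fin 3) (by simp) hf husV hus
  set Fn : ℝ := ‖hf.toLp f‖ with hFndef
  have hFn : Fn = Real.sqrt F := Torus.norm_toLp_eq_sqrt hf
  have hFn0 : 0 < Fn := by rw [hFn]; exact Real.sqrt_pos.2 hFpos
  have hFn2 : Fn ^ 2 = F := by rw [hFn, Real.sq_sqrt hFnn]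
  have hP : 4 * Real.pi ^ 2 * ‖us‖ ^ 2 ≤ G := Torus.norm_sq_le_toReal_eGradNormSq us hfinus
  have hCS : Torus.pairing (us : Lp (EuclideanSpace ℝ (Fin 3)) 2 (volume : Measure (UnitAddTorus (Fin 3)))) f ≤ ‖us‖ * Fn :=
    (le_abs_self _).trans (Torus.abs_pairing_coe_le hf us)
  set Rb : ℝ := 4 * Fn / ν with hRbdef
  have hRb2 : Rb ^ 2 = 16 * F / ν ^ 2 := by
    rw [hRbdef, div_pow, mul_pow, hFn2]; norm_num
  have hpi : (1 : ℝ) ≤ 4 * Real.pi ^ 2 := by nlinarith [Real.pi_gt_three]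
  -- `‖us‖ < Rb`: from `ν · 4π² ‖us‖² ≤ ‖us‖ Fn`
  have hus_lt : ‖us‖ < Rb := by
    have hkey : ν * (4 * Real.pi ^ 2 * ‖us‖ ^ 2) ≤ ‖us‖ * Fn := by nlinarith
    rw [hRbdef, lt_div_iff₀ hν]
    by_cases h0 : ‖us‖ = 0
    · rw [h0, zero_mul]; positivity
    · have hpos : 0 < ‖us‖ := lt_of_le_of_ne (norm_nonneg _) (Ne.symm h0)
      have h1 : ν * (4 * Real.pi ^ 2 * ‖us‖) ≤ Fn := by
        have := hkey
        nlinarith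
      nlinarith
  -- Step C: continuity of the guard-free right-hand side at `us`.
  set g : Torus.energySpace (Fin 3) → ℝ := fun u =>
    Torus.nsGeneratorPairing ν f u (Φ₁.grad u) +
      2 * θ₁ * Torus.pairing (u : Lp (EuclideanSpace ℝ (Fin 3)) 2 (volume : Measure (UnitAddTorus (Fin 3)))) f with hgdef
  have hgc : Continuous g :=
    (Torus.continuous_nsGeneratorPairing_grad ν (hf.integrable one_le_two) Φ₁).add
      (continuous_const.mul (Torus.continuous_pairing_coe hf))
  have hgen0 : Torus.nsGeneratorPairing ν f us (Φ₁.grad us) = 0 :=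
    hus _ (Torus.CylindricalTest.isSmooth_grad_holds Φ₁ us) (Torus.CylindricalTest.isDivFree_grad_holds Φ₁ us)
      (Torus.CylindricalTest.hasZeroMean_grad_holds Φ₁ us)
  have hgus : g us ≤ 0 := by
    have : g us = 2 * θ₁ * (ν * G) := by
      simp only [hgdef, hgen0, zero_add, henergy]
    rw [this]
    exact mul_nonpos_of_nonpos_of_nonneg (by linarith) (mul_nonneg hν.le hG0)
  obtain ⟨δ, hδ, hδg⟩ := Metric.continuous_iff.1 hgc us (ε₀ / 2) (half_pos hε₀)
  -- Step D: the rough state `ut = us + t • r` in the ball, `δ`-close to `us`.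
  set t : ℝ := min δ (Rb - ‖us‖) / (2 * (‖r‖ + 1)) with htdef
  have hmin : 0 < min δ (Rb - ‖us‖) := lt_min hδ (by linarith)
  have ht : 0 < t := by positivity
  have htr : t * ‖r‖ ≤ min δ (Rb - ‖us‖) / 2 := by
    have h1 : t * ‖r‖ ≤ t * (‖r‖ + 1) := mul_le_mul_of_nonneg_left (by linarith) ht.le
    have h2 : t * (‖r‖ + 1) = min δ (Rb - ‖us‖) / 2 := by
      rw [htdef]; field_simp
    linarith
  set ut : Torus.energySpace (Fin 3) := us + t • r with hutdef
  have hdist : dist ut us < δ := by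
    rw [dist_eq_norm, hutdef, add_sub_cancel_left, norm_smul, Real.norm_eq_abs, abs_of_pos ht]
    have := min_le_left δ (Rb - ‖us‖)
    linarith
  have hball : ‖ut‖ ^ 2 ≤ 16 * (∫ x, ‖f x‖ ^ 2) / ν ^ 2 := by
    have hn : ‖ut‖ ≤ ‖us‖ + t * ‖r‖ := by
      calc ‖ut‖ ≤ ‖us‖ + ‖t • r‖ := norm_add_le _ _
        _ = ‖us‖ + t * ‖r‖ := by rw [norm_smul, Real.norm_eq_abs, abs_of_pos ht]
    have hlt : ‖ut‖ < Rb := by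
      have := min_le_right δ (Rb - ‖us‖)
      linarith
    rw [← hFdef, ← hRb2]
    exact pow_le_pow_left₀ (norm_nonneg _) hlt.le 2
  -- Step E: `ut` is rough, so the unguarded floor at `ut` reads `ε₀ ≤ g ut < ε₀/2`.
  have hrough : Torus.eGradNormSq ((ut : Lp (EuclideanSpace ℝ (Fin 3)) 2 (volume : Measure (UnitAddTorus (Fin 3)))) : UnitAddTorus (Fin 3) → EuclideanSpace ℝ (Fin 3)) = ⊤ := by
    by_contra hne
    exact eGradNormSq_ne_top_of_add_smul ht.ne' husV hne hr
  have hfl := hfloor ut hball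
  rw [hrough, ENNReal.toReal_top, mul_zero, zero_add, sub_zero] at hfl
  have hgut : g ut < g us + ε₀ / 2 := by
    have h := hδg ut hdist
    rw [Real.dist_eq] at h
    linarith [(abs_lt.1 h).2]
  have : ε₀ ≤ g ut := hfl
  linarith

/-- **`X` without the finite-enstrophy guard would force `H = V`.** If the crux statement held with the guard
`Torus.eGradNormSq u ≠ ⊤` deleted from its FLOOR block, every finite-energy solenoidal field on `T³` would have finite
enstrophy. (The guard is therefore load-bearing at the formal level: it is what keeps the junk value
`ν·(⊤).toReal = 0` of the dissipation at rough states out of the certificate inequality.) -/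
theorem floorCertificateEnsembleCeiling_withoutGuard_forces_finite_enstrophy
    (hX : ∃ f : UnitAddTorus (Fin 3) → EuclideanSpace ℝ (Fin 3), Torus.IsSmooth f ∧ Torus.IsDivFree f ∧ Torus.HasZeroMean f ∧
      ∃ (ε₀ E ν₀ : ℝ), 0 < ε₀ ∧ 0 < ν₀ ∧ ∀ ν : ℝ, 0 < ν → ν < ν₀ →
        (∃ (Φ₁ : Torus.CylindricalTest (Fin 3)) (θ₁ : ℝ), θ₁ ≤ 0 ∧ ∀ u : Torus.energySpace (Fin 3),
          ‖u‖ ^ 2 ≤ 16 * (∫ x, ‖f x‖ ^ 2) / ν ^ 2 →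
          ε₀ ≤ ν * (Torus.eGradNormSq ((u : Lp (EuclideanSpace ℝ (Fin 3)) 2 (volume : Measure (UnitAddTorus (Fin 3)))) : UnitAddTorus (Fin 3) → EuclideanSpace ℝ (Fin 3))).toReal +
            Torus.nsGeneratorPairing ν f u (Φ₁.grad u) +
            2 * θ₁ * (Torus.pairing (u : Lp (EuclideanSpace ℝ (Fin 3)) 2 (volume : Measure (UnitAddTorus (Fin 3)))) f -
              ν * (Torus.eGradNormSq ((u : Lp (EuclideanSpace ℝ (Fin 3)) 2 (volume : Measure (UnitAddTorus (Fin 3)))) : UnitAddTorus (Fin 3) → EuclideanSpace ℝ (Fin 3))).toReal)) ∧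
        (∀ μ : Measure (Torus.energySpace (Fin 3)), Torus.IsStationaryStatisticalSolution ν f μ →
          Integrable (fun v : Torus.energySpace (Fin 3) => ‖v‖ ^ 2) μ → Torus.ensembleEnergy μ ≤ E))
    (r : Torus.energySpace (Fin 3)) :
    Torus.eGradNormSq ((r : Lp (EuclideanSpace ℝ (Fin 3)) 2 (volume : Measure (UnitAddTorus (Fin 3)))) : UnitAddTorus (Fin 3) → EuclideanSpace ℝ (Fin 3)) ≠ ⊤ := by
  obtain ⟨f, hfs, -, -, ε₀, E, ν₀, hε₀, hν₀, h⟩ := hX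
  obtain ⟨⟨Φ₁, θ₁, hθ₁, hfloor⟩, -⟩ := h (ν₀ / 2) (half_pos hν₀) (half_lt_self hν₀)
  exact floorWithoutGuard_false_at_rough_states (half_pos hν₀) (hfs.memLp 2) hε₀ hθ₁ hfloor r

end Summit.AnomalousDissipation.AnomalousDissipation.Theorems.FloorCertificateEnsembleCeiling.Negative

end
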